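import Summits.QuantumFields.YangMills.Theorems.BalabanUVNodesN15DefectKernel
import Literature.MathematicalPhysics.QuantumFieldTheory.Balaban1983to89.B5Hk163TorusHolderRate
import Literature.MathematicalPhysics.QuantumFieldTheory.Balaban1983to89.T4Hk163StripRate
import Literature.MathematicalPhysics.QuantumFieldTheory.Balaban1983to89.B5Blocks16
import Literature.MathematicalPhysics.QuantumFieldTheory.King1986.MinimizerTowerBridge
import HarnessLib

/-!
# Route «BalabanUVNodes» (K4 «SpineRates»), node N15 = NE2, THE -a ∕ -b INTERFACE OF THE BACKGROUND LAYER, part 8: THE VECTOR INSTANCE OF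
# BINDER (a) — the two-lattice η-rate of Bałaban's Landau-gauge minimiser `H_k` of (1.63) at `U = 1` through King's pairing, with decay, `γ = 1`

Cell `pub-ymgap`, seat `pub-ymgap-dag-n15-a` (KNIT-BY-NAME, generation g3; HUMAN RULING D-0062; chair R424 venue; `bears_on: R4∕N15`).  Filed
`--supports stmt-QuantumFields-19351` (helper).  THEOREMS ONLY; imports BY NAME, nothing in the tree modified: part 1 `BalabanUVNodesN15DefectKernel`
(this seat g2: `hasMaj_ofBlocks_of_entry_le`, `idef_id_pull_single_apply`); the b05 ∕ t4-ne2 lineage of [Balaban1984PropagatorsI] (1.63): `B5Hk163Torus`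
(the TYPED torus operator `HkOp n M` = `H_k`, `hker_bpt`, `gker`, `gker_toT_eq_torusKernel`), `B5Hk163Decay` (`G163`, `phase163`), `B5Hk163Strip` (`dC`),
`B5Hk163TorusHolderDecay` (`D163`, `dgker`, `dgker_toT_eq_torusKernel`, `torusKernel_D163_decay`, `MD163`), `B5Hk163TorusHolderRate`
(`torusSupNorm_sub_rep`), `T4Hk163StripRate` (`torusKernel_G163_rate`, `CGe`), `B5Block118`∕`B5Blocks16` (`bpt`, `bpt_val`, `bpt_bijective`),
`B4TorusKernel` (`periodConst`, `torusSupNorm`), `King1986.MinimizerTowerBridge`∕`TorusBlockForm`∕`UniformDecay` (King's `blockOf`, `val_blockOf`, `tdistT`).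

WHY (NODE-TABLE row n15, -a lane «vector layer by the scalar template»; g2 HANDOFF §g2.3 (a): «the VECTOR instance of binder (a): Bałaban's H_k (1.63)
two-lattice rate on the honest carrier is NOT in the tree — the remaining -a input»).  Part 2 inhabited binder (a) of n15-b's background step with King's
SCALAR minimiser `a_kG_kQ_k^*` (Prop. 3.8 (3.71) line 1) through King's pairing `x′ ∈ B^n(x)`; the VECTOR sibling is Bałaban's Landau-gauge minimiser
`H_k` of (1.63) (`Q_kH_k = I`, `R∂*H_k = 0`), unit-lattice 1-forms → fine-lattice 1-forms.  The tree holds, for its TYPED torus operator `HkOp`, the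
kernel dictionary `H_k((n·y′ + a, μ), (y, λ)) = K_a^{(n)}(y′ − y)` (torus kernel of the fine-offset multiplier `G_a`), the VOLUME-UNIFORM decay, the η-RATE
`‖K_{a′}^{(m)} − K_a^{(n)}‖ ≤ CGe∕n · periodConst · e^{−δ|·|_T}` AT THE SAME PHYSICAL OFFSET (`a′ = (m∕n)·a`, t4-ne2 P2), and the decay of the DERIVATIVE
kernels `∂_νH_k`.  King's pairing compares `H_{m}(x′, ·)` with `H_n(x, ·)` for ALL `x′` over `x` — NOT only the corner `x′₀ = (m∕n)·x` at the same
physical position.  THIS FILE supplies the missing step and assembles the rate: the WITHIN-BLOCK WALK `H_m(x′) − H_m(x′₀)` = a lattice path of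
`≤ (d+1)(R − 1)` forward differences, each `= m⁻¹ · (kernel of ∂_νH_m)` (the offset-step identity `G_{a+e_ν} − G_a = m⁻¹·D_{ν,a}`, §1), hence
`≤ (d+1)∕n · MD163 · periodConst · e^{−δ|y′ − y|_T}`; with the corner rate: **`‖H_{Rn}((x′, μ), (y, λ)) − H_n((x, μ), (y, λ))‖ ≤ C_H∕n · e^{−δ_H|B(x′) − y|_{T₁}}`
for EVERY fine point `x′` over `x`** (`C_H = (CGe(d+1) + (d+1)·MD163(d+1))·periodConst(κ₁₆₃(d+1), d)`, `δ_H = κ₁₆₃(d+1)∕(d+1)`; rate `η¹` — King's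
exponent for the scalar sibling is `L^{−γk}`, `γ` small), uniformly in the volume `M`, in `R` and `n`; and its packaging in binder (a)'s format.

THE PRINT (objects and method only; NO rate of (1.63) is printed — nothing printed is a hypothesis).  [Balaban1984PropagatorsI] (1.63) p. 28 (the
momentum display of `H_k`; typed `B5Hk163Torus.HkOp`), p. 28 last lines (the `l`-sums of the derivative multipliers, `D163`); King CMP **102** (1986)
p. 664 «When x′ ∈ T_{η′}, we denote by x that point in T_η for which x′ ∈ B^n(x)», Prop. 3.8 (3.71) (the scalar SHAPE), p. 672 (4.19) (the `m ≠ 0`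
aliases = the within-block part, handled here in position space).

CONTENTS (all `[folklore]` audit mathematics, kernel-checked).  §1 `phase163_succ`, `G163_succ_sub` (`G_{a+e_ν} − G_a = n⁻¹·D_{ν,a}`), `gker_succ_sub`
(position space); §2 `norm_gker_walk_le` (a monotone offset walk of `S` steps costs `S·n⁻¹·B`, `B` any uniform bound of the derivative kernels); §3 King's
pairing in block coordinates (`pr_bpt`, `blockOf_bpt_king`, `corner_le_and_steps`, `tdistT_eq_torusSupNorm_rep`); §4 **`norm_HkOp_twoLattice_sub_le`** (block
coordinates) and **`norm_HkOp_kingPair_sub_le`** (King's pairing `pr`, King's unit-torus distance `tdistT M (B x′) y`) = THE RATE displayed above;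
§5 **`hasMaj_idef_hk163`** = binder (a)'s format: `𝔇(H_{Rn}, H_n)` through (identity on unit bonds, pull-back along King's pairing on fine bonds), as REAL
linear maps read off by entry binders `hH`, `hH′` (real parts of the typed complex entries; inhabited, `exists_reHkLin`; `pr` by part 2's `exists_kingProj`),
between the sharp cube norms of ANY [B6] carrier and site assignments (`n₀` unit bonds per cube) whose distance is dominated by King's unit-torus block
distance, `δ·d ≤ δ_H·|B(x′) − y|_{T₁}`: block majorant `n₀·(C_H∕n)·e^{−δd(y,y′)}` (flat weight).

HONEST FRAMING ∕ LIMITS.  `U = 1` LINEAR theory on FINITE tori (the b05 torus model: unit torus `Π ℤ∕M_ν`, fine tori `Π ℤ∕(nM_ν)`, `Π ℤ∕(RnM_ν)`), `m² = 0`,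
dimension written `d + 1 ≥ 1`, constants explicit, crude, dimension-only (never Bałaban's `O(1)`); the kernel entries are the TYPED operator's (complex;
§5 reads real parts); nothing with background (`U ≠ 1` = NE2⁺ proper, NOT PRINTED ∕ not proved); the identification of `HkOp` with the (1.60) minimiser
is `B5HkOpLandauMin`'s, not re-asserted; count-neutral (typed 28∕28 · discharged unchanged); NOT a discharge of N15; one finite T⁴ at fixed ε — NOT
infinite volume, NOT OS on ℝ⁴, NOT a mass gap, NOT Clay.
-/

noncomputable section

open scoped BigOperators ComplexConjugate
open Finset Complex

namespace Summit.QuantumFields.YangMills.BalabanUVNodes.N15.DefectKernel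

open Literature.MathematicalPhysics.QuantumFieldTheory.Balaban1983to89
open Literature.MathematicalPhysics.QuantumFieldTheory.Balaban1983to89.B11SectG (BlockNorm HasMaj)
open Literature.MathematicalPhysics.QuantumFieldTheory.Balaban1983to89.T4EtaRateDefect (idef)
open Literature.MathematicalPhysics.QuantumFieldTheory.Balaban1983to89.T4EtaRateCoeffDefect (pull fibre)
open Literature.MathematicalPhysics.QuantumFieldTheory.Balaban1983to89.B4Strip (ofRealVec shift)
open Literature.MathematicalPhysics.QuantumFieldTheory.Balaban1983to89.B4TorusKernel (periodConst)
open Literature.MathematicalPhysics.QuantumFieldTheory.Balaban1983to89.B4TorusKernel.MultiPeriod (torusKernel torusSupNorm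
  torusSupNorm_nonneg)
open Literature.MathematicalPhysics.QuantumFieldTheory.Balaban1983to89.B5Prop11Plancherel (Tor chi fine sOf)
open Literature.MathematicalPhysics.QuantumFieldTheory.Balaban1983to89.B5Block118 (bpt)
open Literature.MathematicalPhysics.QuantumFieldTheory.Balaban1983to89.B5Blocks16 (bpt_val bpt_bijective)
open Literature.MathematicalPhysics.QuantumFieldTheory.Balaban1983to89.B5Hk163Strip (dC h163 kappa163 kappa163_pos)
open Literature.MathematicalPhysics.QuantumFieldTheory.Balaban1983to89.B5Hk163Decay (phase163 G163)
open Literature.MathematicalPhysics.QuantumFieldTheory.Balaban1983to89.B5Hk163Torus (hker HkOp gker hker_bpt gker_toT_eq_torusKernel)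
open Literature.MathematicalPhysics.QuantumFieldTheory.Balaban1983to89.B5Hk163TorusHolderDecay (D163 dgker MD163
  dgker_toT_eq_torusKernel torusKernel_D163_decay)
open Literature.MathematicalPhysics.QuantumFieldTheory.Balaban1983to89.B5Hk163TorusHolderRate (torusSupNorm_sub_rep)
open Literature.MathematicalPhysics.QuantumFieldTheory.Balaban1983to89.T4Hk163StripRate (CGe CGe_nonneg torusKernel_G163_rate)
open Literature.MathematicalPhysics.QuantumFieldTheory.Balaban1983to89.B5Kernel166Decay (toT_sub torFin)
open Literature.MathematicalPhysics.QuantumFieldTheory.Balaban1983to89.B6LowerBound2153Torus (toT rep toT_rep)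
open Literature.MathematicalPhysics.QuantumFieldTheory.Balaban1983to89.B6Cov2156Torus (one_le_M)
open Literature.MathematicalPhysics.QuantumFieldTheory.King1986.Torus (blockOf val_blockOf tdistT)

variable {d : ℕ}

/-! ## §1 One offset step in direction `ν₀`: `G_{a+e_{ν₀}} − G_a = n⁻¹·D_{ν₀,a}` -/

section Step
variable (n : ℕ) [NeZero n]

omit [NeZero n] in
/-- The fine-offset phase one step further in direction `ν₀` picks up the factor `e^{iη(p′+l)_{ν₀}}`:
`phase_{a+e_{ν₀}} = phase_a · e^{i(p′+l)_{ν₀}∕n}`. [folklore] -/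
theorem phase163_succ (k a a' : Fin d → Fin n) (p : Fin d → ℂ) (ν₀ : Fin d) (h₀ : (a' ν₀ : ℕ) = a ν₀ + 1)
    (h₁ : ∀ ν, ν ≠ ν₀ → a' ν = a ν) :
    phase163 n k a' p = phase163 n k a p * Complex.exp (shift n k p ν₀ / n * I) := by
  have hexp : ∀ ν, (a' ν : ℕ) = a ν + (if ν = ν₀ then 1 else 0) := fun ν => by
    by_cases h : ν = ν₀
    · subst h; rw [if_pos rfl, h₀]
    · rw [if_neg h, h₁ ν h, add_zero]
  unfold phase163
  simp_rw [hexp, pow_add, Finset.prod_mul_distrib, pow_ite, pow_one, pow_zero, Finset.prod_ite_eq', Finset.mem_univ,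
    if_true]

/-- **THE OFFSET-STEP IDENTITY** for the coarse multipliers of (1.63): `G_{a+e_{ν₀}}(p′) − G_a(p′) = n⁻¹ · D_{ν₀,a}(p′)` — the difference of the
phases is `phase_a · (e^{iη(p′+l)_{ν₀}} − 1) = phase_a · η·∂_{ν₀}(p′+l)` (`B5Hk163Strip.dC = η⁻¹(e^{iη(·)} − 1)`).
[cite: Balaban1984PropagatorsI, (1.31) p.23 (the symbol of ∂_ν), (1.63) p.28] -/
theorem G163_succ_sub (μ lam ν₀ : Fin d) (a a' : Fin d → Fin n) (h₀ : (a' ν₀ : ℕ) = a ν₀ + 1)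
    (h₁ : ∀ ν, ν ≠ ν₀ → a' ν = a ν) (p : Fin d → ℂ) :
    G163 n μ lam a' p - G163 n μ lam a p = ((n : ℂ))⁻¹ * D163 n μ lam ν₀ a p := by
  have hn : (n : ℂ) ≠ 0 := Nat.cast_ne_zero.mpr (NeZero.ne n)
  unfold G163 D163
  rw [Finset.mul_sum, ← Finset.sum_sub_distrib]
  refine Finset.sum_congr rfl fun k _ => ?_
  rw [phase163_succ n k a a' p ν₀ h₀ h₁]
  unfold dC
  field_simp

/-- … in position space: `K_{a+e_{ν₀}}(w) − K_a(w) = n⁻¹ · (kernel of ∂_{ν₀}H at offset a)(w)` (`B5Hk163Torus.gker`,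
`B5Hk163TorusHolderDecay.dgker`). [folklore] -/
theorem gker_succ_sub (M : Fin d → ℕ) [∀ μ, NeZero (M μ)] (μ lam ν₀ : Fin d) (a a' : Fin d → Fin n)
    (h₀ : (a' ν₀ : ℕ) = a ν₀ + 1) (h₁ : ∀ ν, ν ≠ ν₀ → a' ν = a ν) (w : Tor M) :
    gker n M μ lam a' w - gker n M μ lam a w = ((n : ℂ))⁻¹ * dgker n M μ lam ν₀ a w := by
  have h : ∀ q : Tor M,
      chi M q w * G163 n μ lam a' (ofRealVec (sOf M q)) - chi M q w * G163 n μ lam a (ofRealVec (sOf M q))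
        = ((n : ℂ))⁻¹ * (chi M q w * D163 n μ lam ν₀ a (ofRealVec (sOf M q))) := fun q => by
    rw [← mul_sub, G163_succ_sub n μ lam ν₀ a a' h₀ h₁]; ring
  unfold gker dgker
  rw [← mul_sub, ← Finset.sum_sub_distrib, Finset.sum_congr rfl (fun q _ => h q), ← Finset.mul_sum]
  ring
end Step

/-! ## §2 The within-block walk: a monotone lattice path of `S` offset steps -/

section Walk
variable (n : ℕ) [NeZero n] (M : Fin d → ℕ) [∀ μ, NeZero (M μ)]

/-- **THE WALK**: if the derivative kernels at `w` are uniformly bounded, `‖(kernel of ∂_νH at offset c)(w)‖ ≤ B` for all `ν`, `c`, then for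
offsets `c ≤ c′` (pointwise) `S = Σ_ν (c′_ν − c_ν)` steps apart, `‖K_{c′}(w) − K_c(w)‖ ≤ S · n⁻¹ · B` (induction on `S`: one step by
`gker_succ_sub`). [folklore] -/
theorem norm_gker_walk_le (μ lam : Fin d) {B : ℝ} (w : Tor M)
    (hdg : ∀ (ν : Fin d) (c : Fin d → Fin n), ‖dgker n M μ lam ν c w‖ ≤ B) :
    ∀ (S : ℕ) (c c' : Fin d → Fin n), (∀ ν, (c ν : ℕ) ≤ c' ν) → ∑ ν, ((c' ν : ℕ) - c ν) = S →
      ‖gker n M μ lam c' w - gker n M μ lam c w‖ ≤ S * (((n : ℝ))⁻¹ * B) := by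
  intro S
  induction S with
  | zero =>
    intro c c' hle hS
    have hcc : c = c' := by
      funext ν
      have hν : (c' ν : ℕ) - c ν = 0 := (Finset.sum_eq_zero_iff.mp hS) ν (Finset.mem_univ ν)
      exact Fin.ext (le_antisymm (hle ν) (Nat.sub_eq_zero_iff_le.mp hν))
    subst hcc
    simp
  | succ S ih =>
    intro c c' hle hS
    -- a direction in which the walk is not finished
    obtain ⟨ν₀, hν₀⟩ : ∃ ν₀, (c ν₀ : ℕ) < c' ν₀ := by
      by_contra h
      push Not at h
      have h0 : ∑ ν, ((c' ν : ℕ) - c ν) = 0 :=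
        Finset.sum_eq_zero fun ν _ => Nat.sub_eq_zero_of_le (h ν)
      omega
    -- one step in that direction
    let cs : Fin d → Fin n := fun ν =>
      if h : ν = ν₀ then ⟨c ν₀ + 1, lt_of_le_of_lt (Nat.succ_le_of_lt hν₀) (c' ν₀).isLt⟩ else c ν
    have h₀ : (cs ν₀ : ℕ) = c ν₀ + 1 := by simp [cs]
    have h₁ : ∀ ν, ν ≠ ν₀ → cs ν = c ν := fun ν h => by simp [cs, h]
    have hle₁ : ∀ ν, (c ν : ℕ) ≤ cs ν := fun ν => by
      by_cases h : ν = ν₀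
      · subst h; rw [h₀]; exact Nat.le_succ _
      · rw [h₁ ν h]
    have hle₂ : ∀ ν, (cs ν : ℕ) ≤ c' ν := fun ν => by
      by_cases h : ν = ν₀
      · subst h; rw [h₀]; exact Nat.succ_le_of_lt hν₀
      · rw [h₁ ν h]; exact hle ν
    have hone : ∑ ν, ((cs ν : ℕ) - c ν) = 1 := by
      rw [Finset.sum_eq_single ν₀ (fun ν _ hν => by rw [h₁ ν hν, Nat.sub_self]) (fun h => absurd (Finset.mem_univ _) h),
        h₀, Nat.add_sub_cancel_left]
    have hS' : ∑ ν, ((c' ν : ℕ) - cs ν) = S := by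
      have hsplit : ∑ ν, ((c' ν : ℕ) - c ν) = ∑ ν, ((c' ν : ℕ) - cs ν) + ∑ ν, ((cs ν : ℕ) - c ν) := by
        rw [← Finset.sum_add_distrib]
        exact Finset.sum_congr rfl fun ν _ => by have := hle₁ ν; have := hle₂ ν; omega
      rw [hsplit, hone] at hS
      omega
    have hstep : ‖gker n M μ lam cs w - gker n M μ lam c w‖ ≤ ((n : ℝ))⁻¹ * B := by
      rw [gker_succ_sub n M μ lam ν₀ c cs h₀ h₁ w, norm_mul, norm_inv, Complex.norm_natCast]
      exact mul_le_mul_of_nonneg_left (hdg ν₀ c) (inv_nonneg.mpr (Nat.cast_nonneg _))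
    calc ‖gker n M μ lam c' w - gker n M μ lam c w‖
        = ‖(gker n M μ lam c' w - gker n M μ lam cs w) + (gker n M μ lam cs w - gker n M μ lam c w)‖ := by
          rw [sub_add_sub_cancel]
      _ ≤ ‖gker n M μ lam c' w - gker n M μ lam cs w‖ + ‖gker n M μ lam cs w - gker n M μ lam c w‖ := norm_add_le _ _
      _ ≤ S * (((n : ℝ))⁻¹ * B) + ((n : ℝ))⁻¹ * B := add_le_add (ih cs c' hle₂ hS') hstep
      _ = ((S + 1 : ℕ) : ℝ) * (((n : ℝ))⁻¹ * B) := by push_cast; ring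
end Walk

/-! ## §3 King's pairing in block coordinates -/

section Pairing
variable (R n : ℕ) [NeZero R] [NeZero n] (M : Fin d → ℕ) [∀ μ, NeZero (M μ)]

/-- **King's pairing in block coordinates**: if `(pr x′)_ν = ⌊x′_ν∕R⌋` then `pr (Rn·y′ + a′) = n·y′ + â` for the offset `â_ν = ⌊a′_ν∕R⌋` — a fine point
over `x = n·y′ + â` lies in the SAME unit block `y′`. [cite: King1986, p.664 («x′ ∈ B^n(x)»)] -/
theorem pr_bpt (pr : Tor (fine (R * n) M) → Tor (fine n M)) (hpr : ∀ x' ν, (pr x' ν).val = (x' ν).val / R)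
    (y' : Tor M) (a' : Fin d → Fin (R * n)) (ah : Fin d → Fin n) (hover : ∀ ν, (a' ν : ℕ) / R = (ah ν : ℕ)) :
    pr (bpt (R * n) M y' a') = bpt n M y' ah := by
  have hR : 0 < R := Nat.pos_of_ne_zero (NeZero.ne R)
  funext ν
  apply ZMod.val_injective
  rw [hpr, bpt_val, bpt_val, ← hover ν, show R * n * (y' ν).val + (a' ν : ℕ) = R * (n * (y' ν).val) + (a' ν : ℕ) by ring,
    Nat.mul_add_div hR]

/-- King's unit block of a fine point in block coordinates: `B(Rn·y′ + a′) = y′` (`King1986.Torus.blockOf`, labels `⌊·∕(Rn)⌋`). [folklore] -/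
theorem blockOf_bpt_king (y' : Tor M) (a' : Fin d → Fin (R * n)) : blockOf (R * n) M (bpt (R * n) M y' a') = y' := by
  have hRn : 0 < R * n := Nat.pos_of_ne_zero (NeZero.ne (R * n))
  funext ν
  apply ZMod.val_injective
  rw [val_blockOf, bpt_val, Nat.mul_add_div hRn, Nat.div_eq_of_lt (a' ν).isLt, add_zero]

omit [NeZero n] in
/-- The corner offset `R·â` is below `a′` and the walk from it to `a′` has at most `d·(R − 1)` steps (`a′_ν − R⌊a′_ν∕R⌋ = a′_ν mod R ≤ R − 1`). [folklore] -/
theorem corner_le_and_steps (a' : Fin d → Fin (R * n)) (ah : Fin d → Fin n) (hover : ∀ ν, (a' ν : ℕ) / R = (ah ν : ℕ)) :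
    (∀ ν, R * (ah ν : ℕ) ≤ a' ν) ∧ ∑ ν, ((a' ν : ℕ) - R * (ah ν : ℕ)) ≤ d * (R - 1) := by
  have hR : 0 < R := Nat.pos_of_ne_zero (NeZero.ne R)
  refine ⟨fun ν => by rw [← hover ν]; exact Nat.mul_div_le _ _, ?_⟩
  calc ∑ ν, ((a' ν : ℕ) - R * (ah ν : ℕ)) ≤ ∑ _ν : Fin d, (R - 1) := Finset.sum_le_sum fun ν _ => by
          rw [← hover ν]
          have h1 := Nat.div_add_mod (a' ν : ℕ) R
          have h2 := Nat.mod_lt (a' ν : ℕ) hR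
          omega
    _ = d * (R - 1) := by rw [Finset.sum_const, Finset.card_univ, Fintype.card_fin, smul_eq_mul]
end Pairing

section Dist
variable (M : Fin (d + 1) → ℕ) [∀ μ, NeZero (M μ)]

/-- King's unit-torus distance IS b04's torus sup-norm of the difference of representatives: `|u − v|_{T₁} = |rep u − rep v|_{T,∞}`
(`King1986.Torus.tdistT` and `B4TorusKernel.MultiPeriod.torusSupNorm` read the same circular coordinate distances; `B5Hk163TorusHolderRate.torusSupNorm_sub_rep`).
[folklore] -/
theorem tdistT_eq_torusSupNorm_rep (u v : Tor M) : tdistT M u v = torusSupNorm M (rep M u - rep M v) := by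
  rw [torusSupNorm_sub_rep M (rep M u) v, toT_rep]
  rfl
end Dist

/-! ## §4 The two-lattice η-rate of `H_k` through King's pairing -/

section Rate
variable (R n : ℕ) [NeZero R] [NeZero n] (M : Fin (d + 1) → ℕ) [hM : ∀ μ, NeZero (M μ)]

/-- **THE VECTOR TWO-LATTICE RATE IN BLOCK COORDINATES.**  For every unit torus `Π ℤ∕M_ν` (all `M_ν ≥ 1`), levels `n` and `Rn` (`R, n ≥ 1`), directions
`μ, λ`, a unit block `y′` and a unit bond base point `y` given by integer representatives `x′, x`, and fine offsets `a′ ∈ [0, Rn)^{d+1}` over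
`â ∈ [0, n)^{d+1}` (`⌊a′_ν∕R⌋ = â_ν`):
`‖H_{Rn}((Rn·y′ + a′, μ), (y, λ)) − H_n((n·y′ + â, μ), (y, λ))‖ ≤ (CGe(d+1) + (d+1)·MD163(d+1))·periodConst(κ₁₆₃(d+1), d)∕n · e^{−(κ₁₆₃(d+1)∕(d+1))·|x′ − x|_{T,∞}}`
— the corner rate (`T4Hk163StripRate.torusKernel_G163_rate` at the same physical offset `R·â`) plus the within-block walk (§2, `≤ (d+1)(R−1)` steps of
size `(Rn)⁻¹·MD163·periodConst·e^{−…}`). [cite: Balaban1984PropagatorsI, (1.63) p.28 (object); King1986, Prop. 3.8 (3.71) p.664 (shape, scalar sibling)] -/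
theorem norm_HkOp_twoLattice_sub_le (μ lam : Fin (d + 1)) (a' : Fin (d + 1) → Fin (R * n)) (ah : Fin (d + 1) → Fin n)
    (hover : ∀ ν, (a' ν : ℕ) / R = (ah ν : ℕ)) (x' x : Fin (d + 1) → ℤ) :
    ‖HkOp (R * n) M (bpt (R * n) M (toT M x') a', μ) (toT M x, lam) - HkOp n M (bpt n M (toT M x') ah, μ) (toT M x, lam)‖
      ≤ (CGe (d + 1) + (d + 1) * MD163 (d + 1)) * periodConst (kappa163 (d + 1)) d / n *
          Real.exp (-(kappa163 (d + 1) / (d + 1) * torusSupNorm M (x' - x))) := by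
  have hR : 0 < R := Nat.pos_of_ne_zero (NeZero.ne R)
  have hn : 0 < n := Nat.pos_of_ne_zero (NeZero.ne n)
  have hRr : (0 : ℝ) < R := Nat.cast_pos.mpr hR
  have hnr : (0 : ℝ) < n := Nat.cast_pos.mpr hn
  set E : ℝ := Real.exp (-(kappa163 (d + 1) / (d + 1) * torusSupNorm M (x' - x))) with hE
  have hE0 : 0 < E := Real.exp_pos _
  have hMDpC : 0 ≤ MD163 (d + 1) * periodConst (kappa163 (d + 1)) d :=
    B5Hk163TorusHolderDecay.CdecD_nonneg (d := d)
  -- the entries in kernel form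
  show ‖hker (R * n) M μ lam (bpt (R * n) M (toT M x') a') (toT M x) - hker n M μ lam (bpt n M (toT M x') ah) (toT M x)‖ ≤ _
  rw [hker_bpt, hker_bpt, toT_sub]
  set w : Tor M := toT M (x' - x) with hw
  -- the corner offset `R·â` at level `Rn`
  let a₀ : Fin (d + 1) → Fin (R * n) := fun ν => ⟨R * (ah ν : ℕ), Nat.mul_lt_mul_of_pos_left (ah ν).isLt hR⟩
  have hphys : ∀ ν, (a₀ ν : ℕ) * n = (ah ν : ℕ) * (R * n) := fun ν => by
    show R * (ah ν : ℕ) * n = (ah ν : ℕ) * (R * n); ring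
  obtain ⟨hle, hsteps⟩ := corner_le_and_steps R n a' ah hover
  -- (i) the corner rate at the same physical offset
  have hcorner : ‖gker (R * n) M μ lam a₀ w - gker n M μ lam ah w‖ ≤
      CGe (d + 1) / n * periodConst (kappa163 (d + 1)) d * E := by
    rw [hw, gker_toT_eq_torusKernel, gker_toT_eq_torusKernel]
    exact torusKernel_G163_rate (d := d) (n := n) (m := R * n) hn (Nat.le_mul_of_pos_left n hR) μ lam ah a₀ hphys
      (one_le_M M) (x' - x)
  -- (ii) the within-block walk from the corner to `a′`
  have hdg : ∀ (ν : Fin (d + 1)) (c : Fin (d + 1) → Fin (R * n)),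
      ‖dgker (R * n) M μ lam ν c w‖ ≤ MD163 (d + 1) * periodConst (kappa163 (d + 1)) d * E := fun ν c => by
    rw [hw, dgker_toT_eq_torusKernel]
    exact torusKernel_D163_decay (R * n) μ lam ν c (one_le_M M) (x' - x)
  have hwalk := norm_gker_walk_le (R * n) M μ lam w hdg (∑ ν, ((a' ν : ℕ) - (a₀ ν : ℕ))) a₀ a' hle rfl
  have hSle : ((∑ ν, ((a' ν : ℕ) - (a₀ ν : ℕ)) : ℕ) : ℝ) * (((R * n : ℕ) : ℝ))⁻¹ ≤ (d + 1) / n := by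
    have h1 : ((∑ ν, ((a' ν : ℕ) - (a₀ ν : ℕ)) : ℕ) : ℝ) ≤ (d + 1 : ℕ) * ((R : ℝ) - 1) := by
      have h := hsteps
      have hR1 : 1 ≤ R := hR
      calc ((∑ ν, ((a' ν : ℕ) - (a₀ ν : ℕ)) : ℕ) : ℝ) ≤ (((d + 1) * (R - 1) : ℕ) : ℝ) := by exact_mod_cast h
        _ = (d + 1 : ℕ) * ((R : ℝ) - 1) := by rw [Nat.cast_mul, Nat.cast_sub hR1]; push_cast; ring
    rw [Nat.cast_mul]
    calc ((∑ ν, ((a' ν : ℕ) - (a₀ ν : ℕ)) : ℕ) : ℝ) * (((R : ℝ) * n))⁻¹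
        ≤ (d + 1 : ℕ) * ((R : ℝ) - 1) * (((R : ℝ) * n))⁻¹ :=
          mul_le_mul_of_nonneg_right h1 (inv_nonneg.mpr (mul_nonneg hRr.le hnr.le))
      _ ≤ (d + 1) / n := by
          rw [div_eq_mul_inv]
          push_cast
          rw [mul_inv, ← mul_assoc]
          have : ((d : ℝ) + 1) * ((R : ℝ) - 1) * (R : ℝ)⁻¹ ≤ (d : ℝ) + 1 := by
            rw [mul_assoc]
            apply mul_le_of_le_one_right (by positivity)
            rw [sub_mul, mul_inv_cancel₀ hRr.ne', one_mul]
            linarith [inv_nonneg.mpr hRr.le]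
          exact mul_le_mul_of_nonneg_right this (inv_nonneg.mpr hnr.le)
  have hwalk' : ‖gker (R * n) M μ lam a' w - gker (R * n) M μ lam a₀ w‖ ≤
      (d + 1) / n * (MD163 (d + 1) * periodConst (kappa163 (d + 1)) d * E) := by
    refine hwalk.trans ?_
    rw [← mul_assoc]
    exact mul_le_mul_of_nonneg_right hSle (mul_nonneg hMDpC hE0.le)
  calc ‖gker (R * n) M μ lam a' w - gker n M μ lam ah w‖
      = ‖(gker (R * n) M μ lam a' w - gker (R * n) M μ lam a₀ w) + (gker (R * n) M μ lam a₀ w - gker n M μ lam ah w)‖ := by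
        rw [sub_add_sub_cancel]
    _ ≤ ‖gker (R * n) M μ lam a' w - gker (R * n) M μ lam a₀ w‖ + ‖gker (R * n) M μ lam a₀ w - gker n M μ lam ah w‖ :=
        norm_add_le _ _
    _ ≤ (d + 1) / n * (MD163 (d + 1) * periodConst (kappa163 (d + 1)) d * E)
          + CGe (d + 1) / n * periodConst (kappa163 (d + 1)) d * E := add_le_add hwalk' hcorner
    _ = (CGe (d + 1) + (d + 1) * MD163 (d + 1)) * periodConst (kappa163 (d + 1)) d / n * E := by ring

/-- **THE VECTOR TWO-LATTICE RATE THROUGH KING'S PAIRING.**  For every unit torus `Π ℤ∕M_ν`, levels `n`, `Rn`, any map `pr : T_{η′} → T_η` with King's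
labels `(pr x′)_ν = ⌊x′_ν∕R⌋` («x′ ∈ B^n(x)»), every fine point `x′ ∈ T_{η′}`, unit point `y` and directions `μ, λ`:
`‖H_{Rn}((x′, μ), (y, λ)) − H_n((pr x′, μ), (y, λ))‖ ≤ C_H∕n · e^{−δ_H·|B(x′) − y|_{T₁}}`, `B(x′)` = King's unit block of `x′`
(`King1986.Torus.blockOf`), `|·|_{T₁}` = King's unit-torus distance `tdistT`, `C_H = (CGe(d+1) + (d+1)·MD163(d+1))·periodConst(κ₁₆₃(d+1), d)`,
`δ_H = κ₁₆₃(d+1)∕(d+1)`; uniformly in the volume, in `R` and in `n` — the analogue, for Bałaban's Landau-gauge `H_k` at `U = 1`, of King's (3.71) line 1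
with `γ = 1`. [cite: Balaban1984PropagatorsI, (1.63) p.28 (object); King1986, Prop. 3.8 (3.71) p.664 (shape, scalar sibling)] -/
theorem norm_HkOp_kingPair_sub_le (pr : Tor (fine (R * n) M) → Tor (fine n M)) (hpr : ∀ x' ν, (pr x' ν).val = (x' ν).val / R)
    (μ lam : Fin (d + 1)) (x' : Tor (fine (R * n) M)) (y : Tor M) :
    ‖HkOp (R * n) M (x', μ) (y, lam) - HkOp n M (pr x', μ) (y, lam)‖
      ≤ (CGe (d + 1) + (d + 1) * MD163 (d + 1)) * periodConst (kappa163 (d + 1)) d / n *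
          Real.exp (-(kappa163 (d + 1) / (d + 1) * tdistT M (blockOf (R * n) M x') y)) := by
  have hR : 0 < R := Nat.pos_of_ne_zero (NeZero.ne R)
  -- block coordinates of `x′` and of the point under it
  obtain ⟨⟨y', a'⟩, hx⟩ := (bpt_bijective (R * n) M).2 x'
  simp only at hx
  subst hx
  let ah : Fin (d + 1) → Fin n := fun ν => ⟨(a' ν : ℕ) / R, Nat.div_lt_of_lt_mul (a' ν).isLt⟩
  have hover : ∀ ν, (a' ν : ℕ) / R = (ah ν : ℕ) := fun ν => rfl
  rw [pr_bpt R n M pr hpr y' a' ah hover, blockOf_bpt_king, tdistT_eq_torusSupNorm_rep]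
  have h := norm_HkOp_twoLattice_sub_le R n M μ lam a' ah hover (rep M y') (rep M y)
  rwa [toT_rep, toT_rep] at h
end Rate

/-! ## §5 Binder (a): `𝔇(H_{Rn}, H_n)` through (identity on unit bonds, pull-back along King's pairing on fine bonds) -/

section BinderA
variable (R n : ℕ) [NeZero R] [NeZero n] (M : Fin (d + 1) → ℕ) [hM : ∀ μ, NeZero (M μ)]

/-- The REAL PART of the typed `H_k`'s entries IS a real linear map of unit-lattice 1-forms (the binders `hH`, `hH′` below are inhabited;
`pr` is inhabited by part 2's `exists_kingProj`). [folklore] -/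
theorem exists_reHkLin (N : ℕ) [NeZero N] :
    ∃ H : (Tor M × Fin (d + 1) → ℝ) →ₗ[ℝ] (Tor (fine N M) × Fin (d + 1) → ℝ),
      ∀ b i, H (Pi.single b 1) i = (HkOp N M i b).re := by
  refine ⟨Matrix.mulVecLin ((HkOp N M).map Complex.reLm), fun b i => ?_⟩
  simp [Matrix.mulVec, dotProduct, Pi.single_apply, Matrix.map_apply]

/-- **THE VECTOR INSTANCE OF BINDER (a)** (the -a side of n15-b's background step `idef_background_propagator_majorant`, by part 1's reduction
`hasMaj_ofBlocks_of_entry_le`).  For Bałaban's typed `U = 1` Landau-gauge minimisers `H_n` on `T_η = Π ℤ∕(nM_ν)` and `H_{Rn}` on `T_{η′} = Π ℤ∕(RnM_ν)`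
over the SAME unit torus (read off as real linear maps through their entries, binders `hH`, `hH′`), King's pairing of fine bonds `prV (x′, μ) = (pr x′, μ)`
(`(pr x′)_ν = ⌊x′_ν∕R⌋`), ANY [B6] carrier `g` with site assignments `blk₁` of the unit bonds (at most `n₀` per cube) and `blk₂` of the fine bonds whose
carrier distance is dominated by King's unit-torus block distance, `δ·d(blk₂(x′, μ), blk₁(y, λ)) ≤ δ_H·|B(x′) − y|_{T₁}`: the η-defect
`𝔇(H_{Rn}, H_n) = H_{Rn}·id − (pull prV)·H_n` has, between the sharp cube norms, the block majorant `n₀·(C_H∕n)·e^{−δd(y,y′)}` (flat weight), uniformly in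
the volume and in `R` — rate `η = 1∕n` (`γ = 1`). [cite: Balaban1984PropagatorsI, (1.63) p.28 (object); King1986, Prop. 3.8 (3.71) p.664 (shape); Balaban1985BackgroundPropagators, (3.42) p.397 (the format's use)] -/
theorem hasMaj_idef_hk163 {g : B6.Geometry} [DecidableEq g.Site] (blk₁ : Tor M × Fin (d + 1) → g.Site)
    (blk₂ : Tor (fine (R * n) M) × Fin (d + 1) → g.Site) {n₀ : ℕ} (hn₀ : ∀ y', (fibre blk₁ y').card ≤ n₀)
    (pr : Tor (fine (R * n) M) → Tor (fine n M)) (hpr : ∀ x' ν, (pr x' ν).val = (x' ν).val / R)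
    (prV : Tor (fine (R * n) M) × Fin (d + 1) → Tor (fine n M) × Fin (d + 1)) (hprV : ∀ i, prV i = (pr i.1, i.2))
    (H : (Tor M × Fin (d + 1) → ℝ) →ₗ[ℝ] (Tor (fine n M) × Fin (d + 1) → ℝ))
    (hH : ∀ b i, H (Pi.single b 1) i = (HkOp n M i b).re)
    (H' : (Tor M × Fin (d + 1) → ℝ) →ₗ[ℝ] (Tor (fine (R * n) M) × Fin (d + 1) → ℝ))
    (hH' : ∀ b i, H' (Pi.single b 1) i = (HkOp (R * n) M i b).re)
    {δ : ℝ} (hdom : ∀ (i : Tor (fine (R * n) M) × Fin (d + 1)) (b : Tor M × Fin (d + 1)),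
      δ * g.dist (blk₂ i) (blk₁ b) ≤ kappa163 (d + 1) / (d + 1) * tdistT M (blockOf (R * n) M i.1) b.1) :
    HasMaj (BlockNorm.ofBlocks g blk₁) (BlockNorm.ofBlocks g blk₂) (idef LinearMap.id (pull prV) H' H)
      (fun y y' => n₀ * ((CGe (d + 1) + (d + 1) * MD163 (d + 1)) * periodConst (kappa163 (d + 1)) d / n) *
        Real.exp (-(δ * g.dist y y'))) := by
  set C : ℝ := (CGe (d + 1) + (d + 1) * MD163 (d + 1)) * periodConst (kappa163 (d + 1)) d / n with hCdef
  have hC : 0 ≤ C := by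
    -- `C·e^{−δ_H·0} ≥ ‖entry difference‖ ≥ 0` at any point: read positivity off the rate theorem itself
    obtain ⟨b⟩ : Nonempty (Tor M) := ⟨0⟩
    obtain ⟨x'⟩ : Nonempty (Tor (fine (R * n) M)) := ⟨0⟩
    have h := (norm_nonneg _).trans (norm_HkOp_kingPair_sub_le R n M pr hpr 0 0 x' b)
    have hE : 0 < Real.exp (-(kappa163 (d + 1) / (d + 1) * tdistT M (blockOf (R * n) M x') b)) := Real.exp_pos _
    nlinarith
  have key := hasMaj_ofBlocks_of_entry_le blk₁ blk₂ (T := idef LinearMap.id (pull prV) H' H)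
    (κ := fun y y' => C * Real.exp (-(δ * g.dist y y'))) (fun _ _ => mul_nonneg hC (Real.exp_nonneg _)) hn₀
    fun i b => by
      rw [idef_id_pull_single_apply, hH', hH, hprV, ← Complex.sub_re]
      refine (Complex.abs_re_le_norm _).trans ((norm_HkOp_kingPair_sub_le R n M pr hpr i.2 b.2 i.1 b.1).trans ?_)
      exact mul_le_mul_of_nonneg_left (Real.exp_le_exp.mpr (by linarith [hdom i b])) hC
  exact key.mono fun y y' => le_of_eq (by rw [hCdef]; ring)
end BinderA

end Summit.QuantumFields.YangMills.BalabanUVNodes.N15.DefectKernel
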